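import Literature.Probability.LatticeModels.SixVertexSpectralFTransform
import Mathlib.MeasureTheory.Measure.CharacteristicFunction.Basic

/-!
# Six-vertex spectral measures: the tilted measures `a e^{-ax} μ` (DKLM 2026, Part II §1.3–1.4)

H. Duminil-Copin, K. K. Kozlowski, P. Lammers, I. Manolescu, *Gaussian free field convergence of
the six-vertex model with `-1 ≤ Δ ≤ -1/2`*, arXiv:2603.06268 (2026) [DKLM2026SixVertexGFF]
(`paper:arxiv-2603.06268`, chunks p0025–p0027): Definition 36, `F(x,y) = ∫ a e^{-ax-iby} dμ(a,b)`,
and the proof of Theorem 40 ("since `ae^{-a}` is a strictly positive function on `ℝ_{>0}`, it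
suffices to prove that […] `F(1,0) = ∫ ae^{-a} dμ(a,b) = ∫ 𝟙{|b| ≤ λa} ae^{-a} dμ(a,b)`").

For `μ ∈ 𝓜_{c,C}` (Definition 29) and `x > 0` the **tilted measure** `a e^{-ax} μ` is a finite
measure (domination by `a ∧ 1/a`) from which `μ` is recovered, and `F` is a family of
characteristic functions of its one-dimensional marginals:

* `tiltDensity`, `tiltMeasure`, `tiltMeasure_univ_le`, `isFiniteMeasure_tiltMeasure`,
  `tiltDensity_mul_inv`, `withDensity_inv_tiltMeasure` (`(a e^{-a})⁻¹ (a e^{-a} μ) = μ`),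
  `measure_inter_pos_eq_zero_of_tiltMeasure` (null sets of `a e^{-a} μ` are `μ`-null inside
  `{a > 0}`);
* `charFun_map_snd_tiltMeasure` — `t ↦ F(x,-t)` is the characteristic function of the
  `b`-marginal of `a e^{-ax} μ`;
* `charFun_map_linear_tiltMeasure` — `t ↦ F(1 - iλt, t)` is the characteristic function of the
  image of `a e^{-a} μ` under `(a,b) ↦ λa - b` (the function `F_-` of the proof of Theorem 40).

## References

* H. Duminil-Copin, K. K. Kozlowski, P. Lammers, I. Manolescu, arXiv:2603.06268 (2026), Part II,
  Definition 36 and the proof of Theorem 40. [DKLM2026SixVertexGFF]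
-/

noncomputable section

open MeasureTheory Set Filter Topology Complex
open scoped ENNReal

namespace Literature.Probability.LatticeModels.SixVertex

variable {c C : ℝ} {μ : Measure (ℝ × ℝ)}

/-- The tilting density `a e^{-ax}` (as an `ℝ≥0∞`-valued function; it vanishes for `a ≤ 0`). [folklore] -/
def tiltDensity (x : ℝ) (p : ℝ × ℝ) : ℝ≥0∞ := ENNReal.ofReal (p.1 * Real.exp (-(p.1 * x)))

/-- The tilted measure `a e^{-ax} μ`. [cite: DKLM2026SixVertexGFF, Part II, Definition 36] -/
def tiltMeasure (μ : Measure (ℝ × ℝ)) (x : ℝ) : Measure (ℝ × ℝ) := μ.withDensity (tiltDensity x)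

/-- The tilting density is measurable. [folklore] -/
theorem measurable_tiltDensity (x : ℝ) : Measurable (tiltDensity x) := by
  unfold tiltDensity
  exact (measurable_fst.mul (Real.measurable_exp.comp (measurable_fst.mul_const x).neg)).ennreal_ofReal

/-- The tilted measure of `μ ∈ 𝓜` has total mass `≤ 12 max(1, 2/x²) C` (domination by `a ∧ 1/a`).
[cite: DKLM2026SixVertexGFF, Part II, proof of Lemma 37] -/
theorem tiltMeasure_univ_le (hμ : μ ∈ dklmSpaceM c C) {x : ℝ} (hx : 0 < x) :
    tiltMeasure μ x univ ≤ ENNReal.ofReal (max 1 (2 / x ^ 2)) * (12 * ENNReal.ofReal C) := by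
  rw [tiltMeasure, withDensity_apply _ MeasurableSet.univ, Measure.restrict_univ]
  calc ∫⁻ p, tiltDensity x p ∂μ
      ≤ ∫⁻ p, ENNReal.ofReal (max 1 (2 / x ^ 2)) * ENNReal.ofReal (min p.1 p.1⁻¹) ∂μ := by
        refine lintegral_mono_ae ?_
        filter_upwards [dklmSpaceM_ae_pos hμ] with p hp
        rw [tiltDensity, ← ENNReal.ofReal_mul (by positivity)]
        exact ENNReal.ofReal_le_ofReal (mul_exp_neg_le_min_inv hp hx)
    _ = ENNReal.ofReal (max 1 (2 / x ^ 2)) * ∫⁻ p, ENNReal.ofReal (min p.1 p.1⁻¹) ∂μ :=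
        lintegral_const_mul _ measurable_min_inv.ennreal_ofReal
    _ ≤ ENNReal.ofReal (max 1 (2 / x ^ 2)) * (12 * ENNReal.ofReal C) := by
        gcongr
        exact dklmSpaceM_lintegral_min_inv_le hμ

/-- The tilted measure of `μ ∈ 𝓜` is finite. [cite: DKLM2026SixVertexGFF, Part II, proof of Lemma 37] -/
theorem isFiniteMeasure_tiltMeasure (hμ : μ ∈ dklmSpaceM c C) {x : ℝ} (hx : 0 < x) :
    IsFiniteMeasure (tiltMeasure μ x) :=
  ⟨(tiltMeasure_univ_le hμ hx).trans_lt (ENNReal.mul_lt_top ENNReal.ofReal_lt_top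
    (ENNReal.mul_lt_top (by norm_num) ENNReal.ofReal_lt_top))⟩

/-- **`y ↦ F(x,-y)` is the characteristic function of the `b`-marginal of `a e^{-ax} μ`.**
[cite: DKLM2026SixVertexGFF, Part II, Definition 36] -/
theorem charFun_map_snd_tiltMeasure (hμ : μ ∈ dklmSpaceM c C) (x t : ℝ) :
    charFun ((tiltMeasure μ x).map Prod.snd) t = dklmF μ x (-t) := by
  rw [charFun_apply_real, integral_map measurable_snd.aemeasurable (by fun_prop), tiltMeasure,
    integral_withDensity_eq_integral_toReal_smul (measurable_tiltDensity x) (ae_of_all _ fun _ => ENNReal.ofReal_lt_top),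
    dklmF]
  refine integral_congr_ae ?_
  filter_upwards [dklmSpaceM_ae_pos hμ] with p hp
  rw [tiltDensity, ENNReal.toReal_ofReal (by positivity), fKernel, Complex.real_smul, Complex.ofReal_mul,
    Complex.ofReal_exp, mul_assoc, ← Complex.exp_add]
  congr 2
  push_cast
  ring

/-- `a e^{-a} · (a e^{-a})⁻¹ = 𝟙_{a > 0}` in `ℝ≥0∞`. [folklore] -/
theorem tiltDensity_mul_inv :
    (tiltDensity 1 * fun p => (tiltDensity 1 p)⁻¹) = {p : ℝ × ℝ | 0 < p.1}.indicator 1 := by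
  funext p
  simp only [Pi.mul_apply]
  by_cases hp : 0 < p.1
  · rw [indicator_of_mem (show p ∈ {q : ℝ × ℝ | 0 < q.1} from hp), Pi.one_apply]
    refine ENNReal.mul_inv_cancel ?_ ENNReal.ofReal_ne_top
    exact (ENNReal.ofReal_pos.2 (mul_pos hp (Real.exp_pos _))).ne'
  · rw [indicator_of_notMem (show p ∉ {q : ℝ × ℝ | 0 < q.1} from hp), tiltDensity, ENNReal.ofReal_of_nonpos, zero_mul]
    push Not at hp
    nlinarith [Real.exp_pos (-(p.1 * 1))]

/-- Undoing the tilt: `(a e^{-a})⁻¹ · (a e^{-a} μ) = μ` for `μ ∈ 𝓜` (no mass on `{a ≤ 0}`). [folklore] -/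
theorem withDensity_inv_tiltMeasure (hμ : μ ∈ dklmSpaceM c C) :
    (tiltMeasure μ 1).withDensity (fun p => (tiltDensity 1 p)⁻¹) = μ := by
  rw [tiltMeasure, ← withDensity_mul _ (measurable_tiltDensity 1)
      (show Measurable (fun p => (tiltDensity 1 p)⁻¹) from (measurable_tiltDensity 1).inv),
    tiltDensity_mul_inv, withDensity_indicator_one measurableSet_pos, dklmSpaceM_restrict_pos hμ]

/-- **Null sets of the tilted measure**: if `(a e^{-a} μ)(S) = 0` then `μ(S ∩ {a > 0}) = 0`
("since `ae^{-a}` is a strictly positive function on `ℝ_{>0}`").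
[cite: DKLM2026SixVertexGFF, Part II, proof of Theorem 40] -/
theorem measure_inter_pos_eq_zero_of_tiltMeasure {S : Set (ℝ × ℝ)} (hS : tiltMeasure μ 1 S = 0) :
    μ ({p : ℝ × ℝ | 0 < p.1} ∩ S) = 0 := by
  rw [tiltMeasure, withDensity_apply_eq_zero' (measurable_tiltDensity 1).aemeasurable] at hS
  refine measure_mono_null (inter_subset_inter_left S fun p (hp : 0 < p.1) => ?_) hS
  exact (ENNReal.ofReal_pos.2 (mul_pos hp (Real.exp_pos _))).ne'

/-- **`t ↦ F(1 - iλt, t)` is the characteristic function of `(a e^{-a} μ) ∘ (λa - b)⁻¹`** (the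
function `F_-(t) = ∫ a e^{-a} e^{i(λa-b)t} dμ` of the proof of Theorem 40).
[cite: DKLM2026SixVertexGFF, Part II, proof of Theorem 40, eq. (F_pm)] -/
theorem charFun_map_linear_tiltMeasure (hμ : μ ∈ dklmSpaceM c C) (lam t : ℝ) :
    charFun ((tiltMeasure μ 1).map fun p : ℝ × ℝ => lam * p.1 - p.2) t =
      dklmF μ (1 - I * lam * t) t := by
  have hmeas : Measurable fun p : ℝ × ℝ => lam * p.1 - p.2 := (measurable_fst.const_mul lam).sub measurable_snd
  rw [charFun_apply_real, integral_map hmeas.aemeasurable (by fun_prop), tiltMeasure,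
    integral_withDensity_eq_integral_toReal_smul (measurable_tiltDensity 1) (ae_of_all _ fun _ => ENNReal.ofReal_lt_top),
    dklmF]
  refine integral_congr_ae ?_
  filter_upwards [dklmSpaceM_ae_pos hμ] with p hp
  rw [tiltDensity, ENNReal.toReal_ofReal (by positivity), fKernel, Complex.real_smul, Complex.ofReal_mul,
    Complex.ofReal_exp, mul_assoc, ← Complex.exp_add]
  congr 2
  push_cast
  ring

end Literature.Probability.LatticeModels.SixVertex

end
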